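import Summits.AtomisticToContinuum.Crystallization.Theorems.IsometryAtomsAtomicLawChargesCrystalFiniteOrbitsA
import Summits.AtomisticToContinuum.Crystallization.Theorems.IsometryAtomsAtomicLawChargesCrystalSmallPartsCommute

/-!
# Symmetries of a point set: the inversion symmetry of orbit-ball counts

Helper file D of stub `stub_finiteOrbitsOfChargedClass` (line `Sketch`, crux `AtomicLawChargesCrystal`,
stmt-AtomisticToContinuum-15778).

For a point set `D ⊆ ℝ³` with symmetry "group" `Sym(D) = {g : ℝ³ ≃ᵃⁱ ℝ³ | g '' D = D}`, two points
`a, b ∈ D` with FINITE stabilisers `Stab a`, `Stab b`, and a radius `r` such that the orbit of `b` meets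
`B̄(a, r)` and the orbit of `a` meets `B̄(b, r)` in finite sets, counting the finite set
`Φ = {g ∈ Sym D | dist (g b) a ≤ r}` along `g ↦ g b` and the set `Φ' = {g ∈ Sym D | dist (g a) b ≤ r}` along
`g ↦ g a`, and matching `Φ` with `Φ'` through `g ↦ g⁻¹`, gives the INVERSION SYMMETRY
(`fo_orbitCount_mul_stab`)

  `#(Sym(D)·b ∩ B̄(a, r)) · |Stab b| = #(Sym(D)·a ∩ B̄(b, r)) · |Stab a|`

[cite: LyonsPeres2016, §8.2 (8.4); AldousLyons2007, proof of Thm 3.1]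
-/

noncomputable section

namespace Summit.AtomisticToContinuum.Crystallization.Theorems.IsometryAtomsAtomicLawChargesCrystal

open Set

/-! Closure of `Sym(D)` under products and inverses: `g1a_image_mul`, `g1a_image_inv`
(file `…SmallPartsCommute`). -/

/-! ## Fibres of the orbit map are cosets of the stabiliser -/

/-- The fibre of `g ↦ g b` over an orbit point `p = γ b` inside `Sym(D)` is the left translate by `γ` of the
stabiliser of `b`. [folklore] -/
theorem fo_fibre_eq_image_stab {D : Set (EuclideanSpace ℝ (Fin 3))} (b p : EuclideanSpace ℝ (Fin 3))
    {γ : EuclideanSpace ℝ (Fin 3) ≃ᵃⁱ[ℝ] EuclideanSpace ℝ (Fin 3)} (hγ : γ '' D = D) (hγb : γ b = p) :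
    {g : EuclideanSpace ℝ (Fin 3) ≃ᵃⁱ[ℝ] EuclideanSpace ℝ (Fin 3) | g '' D = D ∧ g b = p} =
      (fun σ => γ * σ) '' {σ : EuclideanSpace ℝ (Fin 3) ≃ᵃⁱ[ℝ] EuclideanSpace ℝ (Fin 3) |
        σ '' D = D ∧ σ b = b} := by
  ext g
  simp only [mem_setOf_eq, mem_image]
  constructor
  · rintro ⟨hg, hgb⟩
    refine ⟨γ⁻¹ * g, ⟨g1a_image_mul (g1a_image_inv hγ) hg, ?_⟩, by group⟩
    rw [AffineIsometryEquiv.coe_mul, Function.comp_apply, hgb, ← hγb, AffineIsometryEquiv.coe_inv,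
      AffineIsometryEquiv.symm_apply_apply]
  · rintro ⟨σ, ⟨hσ, hσb⟩, rfl⟩
    exact ⟨g1a_image_mul hγ hσ, by rw [AffineIsometryEquiv.coe_mul, Function.comp_apply, hσb, hγb]⟩

/-- **Counting symmetries along the orbit map.**  If the stabiliser of `b` in `Sym(D)` is finite and the
orbit of `b` meets `B̄(a, r)` in a finite set, then `Φ = {g ∈ Sym D | dist (g b) a ≤ r}` is finite and
`#Φ = #(Sym(D)·b ∩ B̄(a, r)) · |Stab b|` (requires `b ∈ D`). [folklore] -/
theorem fo_ncard_sym_ball {D : Set (EuclideanSpace ℝ (Fin 3))} (a b : EuclideanSpace ℝ (Fin 3))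
    (hb : b ∈ D) (r : ℝ)
    (hstab : {σ : EuclideanSpace ℝ (Fin 3) ≃ᵃⁱ[ℝ] EuclideanSpace ℝ (Fin 3) | σ '' D = D ∧ σ b = b}.Finite)
    (horb : {s : EuclideanSpace ℝ (Fin 3) | s ∈ D ∧ (∃ g : EuclideanSpace ℝ (Fin 3) ≃ᵃⁱ[ℝ]
      EuclideanSpace ℝ (Fin 3), g '' D = D ∧ g b = s) ∧ dist s a ≤ r}.Finite) :
    {g : EuclideanSpace ℝ (Fin 3) ≃ᵃⁱ[ℝ] EuclideanSpace ℝ (Fin 3) | g '' D = D ∧ dist (g b) a ≤ r}.Finite ∧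
    {g : EuclideanSpace ℝ (Fin 3) ≃ᵃⁱ[ℝ] EuclideanSpace ℝ (Fin 3) | g '' D = D ∧ dist (g b) a ≤ r}.ncard =
      {s : EuclideanSpace ℝ (Fin 3) | s ∈ D ∧ (∃ g : EuclideanSpace ℝ (Fin 3) ≃ᵃⁱ[ℝ]
        EuclideanSpace ℝ (Fin 3), g '' D = D ∧ g b = s) ∧ dist s a ≤ r}.ncard *
      {σ : EuclideanSpace ℝ (Fin 3) ≃ᵃⁱ[ℝ] EuclideanSpace ℝ (Fin 3) | σ '' D = D ∧ σ b = b}.ncard := by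
  classical
  set Ob : Set (EuclideanSpace ℝ (Fin 3)) := {s | s ∈ D ∧ (∃ g : EuclideanSpace ℝ (Fin 3) ≃ᵃⁱ[ℝ]
      EuclideanSpace ℝ (Fin 3), g '' D = D ∧ g b = s) ∧ dist s a ≤ r} with hOb
  set St : Set (EuclideanSpace ℝ (Fin 3) ≃ᵃⁱ[ℝ] EuclideanSpace ℝ (Fin 3)) :=
    {σ | σ '' D = D ∧ σ b = b} with hSt
  set Φ : Set (EuclideanSpace ℝ (Fin 3) ≃ᵃⁱ[ℝ] EuclideanSpace ℝ (Fin 3)) :=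
    {g | g '' D = D ∧ dist (g b) a ≤ r} with hΦ
  -- the fibres of `g ↦ g b`
  let fib : EuclideanSpace ℝ (Fin 3) → Set (EuclideanSpace ℝ (Fin 3) ≃ᵃⁱ[ℝ] EuclideanSpace ℝ (Fin 3)) :=
    fun p => {g | g '' D = D ∧ g b = p}
  have hfib_card : ∀ p ∈ Ob, (fib p).Finite ∧ (fib p).ncard = St.ncard := by
    rintro p ⟨-, ⟨γ, hγ, hγb⟩, -⟩
    have heq : fib p = (fun σ => γ * σ) '' St := fo_fibre_eq_image_stab b p hγ hγb
    rw [heq]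
    exact ⟨hstab.image _, Set.ncard_image_of_injective _ (mul_right_injective γ)⟩
  -- `Φ` is the disjoint union of the fibres over `Ob`
  have hΦeq : Φ = ⋃ p ∈ Ob, fib p := by
    ext g
    simp only [hΦ, mem_setOf_eq, mem_iUnion, exists_prop, fib]
    constructor
    · rintro ⟨hg, hr⟩
      refine ⟨g b, ⟨?_, ⟨g, hg, rfl⟩, hr⟩, hg, rfl⟩
      have : g b ∈ g '' D := ⟨b, hb, rfl⟩
      rwa [hg] at this
    · rintro ⟨p, ⟨-, -, hr⟩, hg, rfl⟩
      exact ⟨hg, hr⟩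
  have hΦfin : Φ.Finite := by
    rw [hΦeq]
    exact horb.biUnion fun p hp => (hfib_card p hp).1
  refine ⟨hΦfin, ?_⟩
  -- count with finsets, fibrewise
  have hmaps : ∀ g ∈ hΦfin.toFinset, g b ∈ horb.toFinset := by
    intro g hg
    rw [Set.Finite.mem_toFinset] at hg ⊢
    have : g ∈ ⋃ p ∈ Ob, fib p := hΦeq ▸ hg
    simp only [mem_iUnion, exists_prop, fib, mem_setOf_eq] at this
    obtain ⟨p, hp, -, rfl⟩ := this
    exact hp
  have hcount := Finset.card_eq_sum_card_fiberwise hmaps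
  rw [Set.ncard_eq_toFinset_card _ hΦfin, hcount, Set.ncard_eq_toFinset_card _ horb,
    Finset.card_eq_sum_ones (horb.toFinset), Finset.sum_mul, one_mul]
  refine Finset.sum_congr rfl fun p hp => ?_
  rw [Set.Finite.mem_toFinset] at hp
  have hfilter : (hΦfin.toFinset.filter fun g => g b = p) = (hfib_card p hp).1.toFinset := by
    ext g
    simp only [Finset.mem_filter, Set.Finite.mem_toFinset, hΦ, mem_setOf_eq, fib]
    constructor
    · rintro ⟨⟨hg, -⟩, hgb⟩
      exact ⟨hg, hgb⟩
    · rintro ⟨hg, hgb⟩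
      exact ⟨⟨hg, by rw [hgb]; exact hp.2.2⟩, hgb⟩
  rw [hfilter, ← Set.ncard_eq_toFinset_card _ (hfib_card p hp).1, (hfib_card p hp).2]

/-- `g ↦ g⁻¹` maps `{g ∈ Sym D | dist (g b) a ≤ r}` onto `{g ∈ Sym D | dist (g a) b ≤ r}`. [folklore] -/
theorem fo_inv_image_sym_ball {D : Set (EuclideanSpace ℝ (Fin 3))} (a b : EuclideanSpace ℝ (Fin 3))
    (r : ℝ) :
    (fun g => g⁻¹) '' {g : EuclideanSpace ℝ (Fin 3) ≃ᵃⁱ[ℝ] EuclideanSpace ℝ (Fin 3) |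
        g '' D = D ∧ dist (g b) a ≤ r} =
      {g : EuclideanSpace ℝ (Fin 3) ≃ᵃⁱ[ℝ] EuclideanSpace ℝ (Fin 3) | g '' D = D ∧ dist (g a) b ≤ r} := by
  have key : ∀ g : EuclideanSpace ℝ (Fin 3) ≃ᵃⁱ[ℝ] EuclideanSpace ℝ (Fin 3),
      dist (g⁻¹ a) b = dist (g b) a := by
    intro g
    rw [AffineIsometryEquiv.coe_inv, ← g.dist_map, AffineIsometryEquiv.apply_symm_apply, dist_comm]
  ext h
  simp only [mem_image, mem_setOf_eq]
  constructor
  · rintro ⟨g, ⟨hg, hr⟩, rfl⟩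
    exact ⟨g1a_image_inv hg, by rwa [key]⟩
  · rintro ⟨hh, hr⟩
    refine ⟨h⁻¹, ⟨g1a_image_inv hh, ?_⟩, inv_inv h⟩
    rw [← inv_inv h] at hr
    rwa [key] at hr

/-- **Inversion symmetry of orbit-ball counts.**  For `a, b ∈ D` with finite stabilisers and finite
orbit-ball sets (as below),
`#(Sym(D)·b ∩ B̄(a, r)) · |Stab b| = #(Sym(D)·a ∩ B̄(b, r)) · |Stab a|`: both sides count the symmetries
`g` with `dist (g b) a ≤ r`, respectively their inverses. [cite: LyonsPeres2016, §8.2] -/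
theorem fo_orbitCount_mul_stab {D : Set (EuclideanSpace ℝ (Fin 3))} (a b : EuclideanSpace ℝ (Fin 3))
    (ha : a ∈ D) (hb : b ∈ D) (r : ℝ)
    (hstab_a : {σ : EuclideanSpace ℝ (Fin 3) ≃ᵃⁱ[ℝ] EuclideanSpace ℝ (Fin 3) | σ '' D = D ∧ σ a = a}.Finite)
    (hstab_b : {σ : EuclideanSpace ℝ (Fin 3) ≃ᵃⁱ[ℝ] EuclideanSpace ℝ (Fin 3) | σ '' D = D ∧ σ b = b}.Finite)
    (horb_b : {s : EuclideanSpace ℝ (Fin 3) | s ∈ D ∧ (∃ g : EuclideanSpace ℝ (Fin 3) ≃ᵃⁱ[ℝ]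
      EuclideanSpace ℝ (Fin 3), g '' D = D ∧ g b = s) ∧ dist s a ≤ r}.Finite)
    (horb_a : {s : EuclideanSpace ℝ (Fin 3) | s ∈ D ∧ (∃ g : EuclideanSpace ℝ (Fin 3) ≃ᵃⁱ[ℝ]
      EuclideanSpace ℝ (Fin 3), g '' D = D ∧ g a = s) ∧ dist s b ≤ r}.Finite) :
    {s : EuclideanSpace ℝ (Fin 3) | s ∈ D ∧ (∃ g : EuclideanSpace ℝ (Fin 3) ≃ᵃⁱ[ℝ]
        EuclideanSpace ℝ (Fin 3), g '' D = D ∧ g b = s) ∧ dist s a ≤ r}.ncard *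
      {σ : EuclideanSpace ℝ (Fin 3) ≃ᵃⁱ[ℝ] EuclideanSpace ℝ (Fin 3) | σ '' D = D ∧ σ b = b}.ncard =
    {s : EuclideanSpace ℝ (Fin 3) | s ∈ D ∧ (∃ g : EuclideanSpace ℝ (Fin 3) ≃ᵃⁱ[ℝ]
        EuclideanSpace ℝ (Fin 3), g '' D = D ∧ g a = s) ∧ dist s b ≤ r}.ncard *
      {σ : EuclideanSpace ℝ (Fin 3) ≃ᵃⁱ[ℝ] EuclideanSpace ℝ (Fin 3) | σ '' D = D ∧ σ a = a}.ncard := by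
  obtain ⟨_, h1⟩ := fo_ncard_sym_ball a b hb r hstab_b horb_b
  obtain ⟨_, h2⟩ := fo_ncard_sym_ball b a ha r hstab_a horb_a
  rw [← h1, ← h2, ← fo_inv_image_sym_ball a b r, Set.ncard_image_of_injective _ inv_injective]

/-- **Registered sub-goal D of stub `stub_finiteOrbitsOfChargedClass`** (binder-free packaging of the
inversion symmetry `fo_orbitCount_mul_stab` for the ledger's stub registry). [cite: LyonsPeres2016, §8.2] -/
theorem fo_subgoalD_orbitCountMulStab : ∀ (D : Set (EuclideanSpace ℝ (Fin 3))) (a b : EuclideanSpace ℝ (Fin 3)), a ∈ D → b ∈ D → ∀ r : ℝ, {σ : EuclideanSpace ℝ (Fin 3) ≃ᵃⁱ[ℝ] EuclideanSpace ℝ (Fin 3) | σ '' D = D ∧ σ a = a}.Finite → {σ : EuclideanSpace ℝ (Fin 3) ≃ᵃⁱ[ℝ] EuclideanSpace ℝ (Fin 3) | σ '' D = D ∧ σ b = b}.Finite → {s : EuclideanSpace ℝ (Fin 3) | s ∈ D ∧ (∃ g : EuclideanSpace ℝ (Fin 3) ≃ᵃⁱ[ℝ] EuclideanSpace ℝ (Fin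 3), g '' D = D ∧ g b = s) ∧ dist s a ≤ r}.Finite → {s : EuclideanSpace ℝ (Fin 3) | s ∈ D ∧ (∃ g : EuclideanSpace ℝ (Fin 3) ≃ᵃⁱ[ℝ] EuclideanSpace ℝ (Fin 3), g '' D = D ∧ g a = s) ∧ dist s b ≤ r}.Finite → {s : EuclideanSpace ℝ (Fin 3) | s ∈ D ∧ (∃ g : EuclideanSpace ℝ (Fin 3) ≃ᵃⁱ[ℝ] EuclideanSpace ℝ (Fin 3), g '' D = D ∧ g b = s) ∧ dist s a ≤ r}.ncard * {σ : EuclideanSpace ℝ (Fin 3) ≃ᵃⁱ[ℝ] EuclideanSpace ℝ (Fin 3) | σ '' D = D ∧ σ b = b}.ncard = {s : EuclideanSpace ℝ (Fin 3) | s ∈ D ∧ (∃ g : EuclideanSpace ℝ (Fin 3) ≃ᵃⁱ[ℝ] EuclideanSpace ℝ (Fin 3), g '' D = D ∧ g a = s) ∧ dist s b ≤ r}.ncard * {σ : EuclideanSpace ℝ (Fin 3) ≃ᵃⁱ[ℝ] EuclideanSpace ℝ (Fin 3) | σ '' D = D ∧ σ a = a}.ncard :=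
  fun _ a b ha hb r h1 h2 h3 h4 => fo_orbitCount_mul_stab a b ha hb r h1 h2 h3 h4

end Summit.AtomisticToContinuum.Crystallization.Theorems.IsometryAtomsAtomicLawChargesCrystal

end
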